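/-
# Solo-blind programme on Kontsevich–Zagier, s6 part T4a: the five-term relation, I — the wedge

First of four files establishing the **five-term relation of the dilogarithm inside KZ's three
rules** (no Stokes move): for real algebraic `0 < x, y < 1`,

  `[D(x)] + [D(y)] − [D(xy)] − [D(x(1−y)/(1−xy))] − [D(y(1−x)/(1−xy))]
      = ℓ((1−xy)/(1−x)) · ℓ((1−xy)/(1−y))`   in `Q = FormalRep/relations`,

`D(u) = [0 < t₁ < t₀ < u, dt/(t₀(1−t₁))]` the dilogarithm cell of `SoloBlindDilogCut` (period
`Li₂(u)`).
The classical proof differentiates in `x`; here the derivative bookkeeping is replaced by four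
two-dimensional charts and three dissections.  This file does the first step: the line `t₁ = y·t₀`
through the origin dissects the triangle of `D(x)` into the lower part `W`, which the dilation
`(t₀, t₁) ↦ (y t₀, t₁)` (it preserves the form `dt₀/t₀ · dt₁/(1−t₁)`) maps onto the triangle of
`D(xy)`, and the **wedge** `V = {y t₀ < t₁ < t₀ < x}`:

  `[D(x)] − [D(xy)] = [V, dt/(t₀(1−t₁))]`   (`mkQ_ftWedge`).
-/
import Summits.KontsevichZagierPeriods.KontsevichZagierPeriods.Theorems.SoloBlindDilogCut

noncomputable section

open MeasureTheory Set MvPolynomial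
open Literature.NumberTheory.Transcendental
open Literature.NumberTheory.Transcendental.KZ
open Literature.NumberTheory.Transcendental.KZ.IntegralRep
open Literature.ModelTheory.ExponentialFields (IsSemialgebraic isSemialgebraic_setOf_eval_pos)

namespace Summit.KontsevichZagierPeriods.KontsevichZagierPeriods.Theorems

namespace SoloBlind

/-! ## The product cut -/

namespace Cut

variable (a c : Cut)

/-- The product `xy` of two cuts is a cut. -/
def mul : Cut := ⟨a.x * c.x, a.alg.mul c.alg, mul_pos a.pos c.pos,
  mul_lt_one_of_nonneg_of_lt_one_left a.pos.le a.lt_one c.lt_one.le⟩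

/-- Its point. -/
@[simp] theorem mul_x : (a.mul c).x = a.x * c.x := rfl

end Cut

variable (a c : Cut)

/-! ## The two pieces of `D(x)` cut by the line `t₁ = y t₀` -/

/-- The lower piece `W = {0 < t₁ < y t₀, t₀ < x}`. -/
def ftLowDom : Set (Fin 2 → ℝ) := {p | 0 < p 1 ∧ p 1 < c.x * p 0 ∧ p 0 < a.x}

/-- The wedge `V = {0 < t₀ < x, y t₀ < t₁ < t₀}`. -/
def ftWedgeDom : Set (Fin 2 → ℝ) := {p | 0 < p 0 ∧ c.x * p 0 < p 1 ∧ p 1 < p 0 ∧ p 0 < a.x}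

/-- `t ↦ y·t₀` is a semialgebraic function (algebraic coefficient). -/
theorem isSemialgebraicFunOn_mul_apply {S : Set (Fin 2 → ℝ)} (hS : IsSemialgebraic ℚ S) :
    IsSemialgebraicFunOn ℚ S fun p => c.x * p 0 :=
  (IsSemialgebraicFunOn.mul_holds (isSemialgebraicFunOn_const_of_isAlgebraic hS c.alg)
    (isSemialgebraicFunOn_aeval hS (X 0))).congr fun p _ => by simp

/-- `W` is semialgebraic. -/
theorem isSemialgebraic_ftLowDom : IsSemialgebraic ℚ (ftLowDom a c) := by
  have h1 : IsSemialgebraic ℚ {p : Fin 2 → ℝ | 0 < p 1} := by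
    simpa using isSemialgebraic_setOf_eval_pos (k := ℚ) (R := ℝ) (X 1 : MvPolynomial (Fin 2) ℚ)
  have h2 := isSemialgebraic_sep_apply_lt h1 0 a.alg
  convert isSemialgebraic_sep_lt (isSemialgebraicFunOn_aeval h2 (X 1))
    (isSemialgebraicFunOn_mul_apply c h2) using 1
  ext p; simp only [ftLowDom, mem_setOf_eq, aeval_X]; tauto

/-- `V` is semialgebraic. -/
theorem isSemialgebraic_ftWedgeDom : IsSemialgebraic ℚ (ftWedgeDom a c) := by
  have h1 : IsSemialgebraic ℚ {p : Fin 2 → ℝ | 0 < p 0 ∧ p 1 < p 0} := by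
    have e : {p : Fin 2 → ℝ | 0 < p 0 ∧ p 1 < p 0} =
        {p | 0 < aeval p (X 0 : MvPolynomial (Fin 2) ℚ)} ∩
          {p | 0 < aeval p (X 0 - X 1 : MvPolynomial (Fin 2) ℚ)} := by
      ext p; simp [sub_pos]
    rw [e]; exact (isSemialgebraic_setOf_eval_pos _).inter (isSemialgebraic_setOf_eval_pos _)
  have h2 := isSemialgebraic_sep_apply_lt h1 0 a.alg
  convert isSemialgebraic_sep_lt (isSemialgebraicFunOn_mul_apply c h2)
    (isSemialgebraicFunOn_aeval h2 (X 1)) using 1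
  ext p; simp only [ftWedgeDom, mem_setOf_eq, aeval_X]; tauto

/-- `W ⊆ D(x)`. -/
theorem ftLowDom_subset : ftLowDom a c ⊆ cutDom a := fun p ⟨h1, h2, h3⟩ => by
  have h0 : 0 < p 0 := by
    by_contra h
    have : c.x * p 0 ≤ 0 := mul_nonpos_of_nonneg_of_nonpos c.pos.le (not_lt.1 h)
    linarith
  have h4 : c.x * p 0 < p 0 := by nlinarith [c.lt_one]
  exact ⟨h1, h2.trans h4, h3⟩

/-- `V ⊆ D(x)`. -/
theorem ftWedgeDom_subset : ftWedgeDom a c ⊆ cutDom a := fun _ ⟨h0, h1, h2, h3⟩ =>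
  ⟨(mul_pos c.pos h0).trans h1, h2, h3⟩

/-- The lower piece with the dilogarithm form. -/
def ftLow : IntegralRep 2 :=
  ratRep (ftLowDom a c) dilogFun 1 (X 0 * (1 - X 1)) (isSemialgebraic_ftLowDom a c)
    (fun t ht => by simpa using dilogDen_ne_zero (cutDom_subset a (ftLowDom_subset a c ht)))
    (fun t _ => by simp [dilogFun])
    (integrableOn_dilogFun ((ftLowDom_subset a c).trans (cutDom_subset a))
      (IsSemialgebraic.measurableSet_holds (isSemialgebraic_ftLowDom a c)))

/-- **The wedge** `V = [0 < t₀ < x, y t₀ < t₁ < t₀, dt/(t₀(1−t₁))]`. -/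
def ftWedge : IntegralRep 2 :=
  ratRep (ftWedgeDom a c) dilogFun 1 (X 0 * (1 - X 1)) (isSemialgebraic_ftWedgeDom a c)
    (fun t ht => by simpa using dilogDen_ne_zero (cutDom_subset a (ftWedgeDom_subset a c ht)))
    (fun t _ => by simp [dilogFun])
    (integrableOn_dilogFun ((ftWedgeDom_subset a c).trans (cutDom_subset a))
      (IsSemialgebraic.measurableSet_holds (isSemialgebraic_ftWedgeDom a c)))

/-! ## Move (1a): `D(x) = W ⊔ V` up to the null line `t₁ = y t₀` (a proper linear subspace) -/

/-- **Dissection move.** `[D(x)] − [W] − [V]` is a relation. -/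
theorem dilogCut_dissect_wedge :
    of (dilogCut a) - of (ftLow a c) - of (ftWedge a c) ∈ relations := by
  let R : Fin 2 → IntegralRep 2 := ![ftLow a c, ftWedge a c]
  have hR : ∀ i, (R i).domain ⊆ cutDom a ∧ (R i).integrand = dilogFun := by
    intro i; fin_cases i
    exacts [⟨ftLowDom_subset a c, rfl⟩, ⟨ftWedgeDom_subset a c, rfl⟩]
  have h := of_sub_sum_of_mem_relations (Finset.univ : Finset (Fin 2)) (dilogCut a) R
    (fun i _ => measure_mono_null (fun t ht => absurd ((hR i).1 ht.1) ht.2) measure_empty)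
    (fun i _ t _ => by rw [(hR i).2]; rfl) ?_ ?_
  · have e : ∑ i : Fin 2, of (R i) = of (ftLow a c) + of (ftWedge a c) := by
      rw [Fin.sum_univ_two]; rfl
    rw [e] at h; convert h using 1; abel
  · have hline : volume {p : Fin 2 → ℝ | p 1 = c.x * p 0} = 0 := by
      let L : (Fin 2 → ℝ) →ₗ[ℝ] ℝ :=
        LinearMap.proj (R := ℝ) (φ := fun _ : Fin 2 => ℝ) 1 -
          c.x • LinearMap.proj (R := ℝ) (φ := fun _ : Fin 2 => ℝ) 0
      have hS : {p : Fin 2 → ℝ | p 1 = c.x * p 0} = (LinearMap.ker L : Set (Fin 2 → ℝ)) := by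
        ext p; simp [L, sub_eq_zero]
      have hne : LinearMap.ker L ≠ ⊤ := by
        intro h
        have hm : (![0, 1] : Fin 2 → ℝ) ∈ LinearMap.ker L := h ▸ Submodule.mem_top
        simp [L] at hm
      rw [hS]
      exact Measure.addHaar_submodule volume _ hne
    refine measure_mono_null (fun t ht => ?_) hline
    obtain ⟨ht, hn⟩ := ht
    change t ∈ cutDom a at ht
    simp only [mem_iUnion, Finset.mem_univ, exists_true_left, not_exists] at hn
    have h0 : t ∉ ftLowDom a c := hn 0
    have h1 : t ∉ ftWedgeDom a c := hn 1
    simp only [cutDom, ftLowDom, ftWedgeDom, mem_setOf_eq, not_and, not_lt] at ht h0 h1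
    by_contra hne
    rcases lt_or_gt_of_ne hne with hl | hg
    · exact absurd (h0 ht.1 hl) (not_le.2 ht.2.2)
    · exact absurd (h1 (ht.1.trans ht.2.1) hg ht.2.1) (not_le.2 ht.2.2)
  · intro i _ j _ hij
    have key : ftLowDom a c ∩ ftWedgeDom a c = ∅ :=
      eq_empty_of_forall_notMem fun t ⟨h0, h1⟩ => by
        simp only [ftLowDom, ftWedgeDom, mem_setOf_eq] at h0 h1; linarith [h0.2.1, h1.2.1]
    fin_cases i <;> fin_cases j
    · exact absurd rfl hij
    · show volume (ftLowDom a c ∩ ftWedgeDom a c) = 0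
      rw [key, measure_empty]
    · show volume (ftWedgeDom a c ∩ ftLowDom a c) = 0
      rw [inter_comm, key, measure_empty]
    · exact absurd rfl hij

/-! ## Move (2): the dilation maps `W` onto `D(xy)` -/

/-- The dilation `(t₀, t₁) ↦ (y t₀, t₁)`. -/
def dilChart (p : Fin 2 → ℝ) : Fin 2 → ℝ := ![c.x * p 0, p 1]

/-- Its (constant) derivative. -/
def dilDeriv : (Fin 2 → ℝ) →L[ℝ] (Fin 2 → ℝ) := ContinuousLinearMap.pi ![c.x • pr2 0, pr2 1]

/-- The dilation has the stated derivative. -/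
theorem hasFDerivAt_dilChart (p : Fin 2 → ℝ) : HasFDerivAt (dilChart c) (dilDeriv c) p := by
  rw [hasFDerivAt_pi']
  intro i
  have hrow : (pr2 i).comp (dilDeriv c) = ![c.x • pr2 0, pr2 1] i :=
    ContinuousLinearMap.ext fun v => by simp [dilDeriv]
  rw [hrow]
  fin_cases i
  · simpa [dilChart] using (hasFDerivAt_apply (0 : Fin 2) p).const_mul c.x
  · simpa [dilChart] using hasFDerivAt_apply (1 : Fin 2) p

/-- The matrix of the derivative. -/
theorem toMatrix_dilDeriv :
    LinearMap.toMatrix' ((dilDeriv c : (Fin 2 → ℝ) →L[ℝ] (Fin 2 → ℝ)) :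
      (Fin 2 → ℝ) →ₗ[ℝ] (Fin 2 → ℝ)) = !![c.x, 0; 0, 1] := by
  ext i j
  rw [LinearMap.toMatrix'_apply, ContinuousLinearMap.coe_coe]
  fin_cases i <;> fin_cases j <;> simp [dilDeriv]

/-- `|det| = y`. -/
theorem abs_det_dilDeriv : |(dilDeriv c).det| = c.x := by
  rw [ContinuousLinearMap.det, ← LinearMap.det_toMatrix', toMatrix_dilDeriv, Matrix.det_fin_two_of]
  simp only [mul_one, mul_zero, sub_zero]
  exact abs_of_pos c.pos

/-- The dilation is injective. -/
theorem injective_dilChart : Function.Injective (dilChart c) := by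
  intro s t h
  have h0 := congr_fun h 0
  have h1 := congr_fun h 1
  simp only [dilChart, Matrix.cons_val_zero, Matrix.cons_val_one] at h0 h1
  have e0 := mul_left_cancel₀ c.pos.ne' h0
  funext i
  fin_cases i
  · exact e0
  · exact h1

/-- The dilation maps `W` onto `D(xy)`. -/
theorem image_dilChart : dilChart c '' ftLowDom a c = cutDom (a.mul c) := by
  have hy := c.pos
  ext u
  simp only [mem_image, ftLowDom, cutDom, Cut.mul_x, mem_setOf_eq]
  constructor
  · rintro ⟨t, ⟨h1, h2, h3⟩, rfl⟩
    simp only [dilChart, Matrix.cons_val_zero, Matrix.cons_val_one]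
    refine ⟨h1, h2, ?_⟩
    rw [mul_comm a.x]
    exact mul_lt_mul_of_pos_left h3 hy
  · rintro ⟨h1, h2, h3⟩
    refine ⟨![c.x⁻¹ * u 0, u 1], ⟨h1, ?_, ?_⟩, ?_⟩
    · show u 1 < c.x * (c.x⁻¹ * u 0)
      rwa [← mul_assoc, mul_inv_cancel₀ hy.ne', one_mul]
    · show c.x⁻¹ * u 0 < a.x
      rw [inv_mul_lt_iff₀ hy, mul_comm]
      exact h3
    · funext i
      fin_cases i
      · show c.x * (c.x⁻¹ * u 0) = u 0
        rw [← mul_assoc, mul_inv_cancel₀ hy.ne', one_mul]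
      · rfl

/-- The dilation is `ℚ`-semialgebraic (linear with an algebraic coefficient). -/
theorem isSemialgebraicMapOn_dilChart : IsSemialgebraicMapOn ℚ (ftLowDom a c) (dilChart c) := by
  have hS := isSemialgebraic_ftLowDom a c
  refine IsSemialgebraicMapOn.of_forall hS fun i => ?_
  fin_cases i
  · exact (isSemialgebraicFunOn_mul_apply c hS).congr fun t _ => by simp [dilChart]
  · exact (isSemialgebraicFunOn_aeval hS (X 1)).congr fun t _ => by simp [dilChart]

/-- The dilogarithm form is dilation-invariant up to the Jacobian:
`dilogFun t = dilogFun (y t₀, t₁) · y`. -/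
theorem dilogFun_eq_dilChart (t : Fin 2 → ℝ) : dilogFun t = dilogFun (dilChart c t) * c.x := by
  have hy := c.pos.ne'
  simp only [dilogFun, dilChart, Matrix.cons_val_zero, Matrix.cons_val_one]
  by_cases h0 : t 0 = 0
  · simp [h0]
  by_cases h1 : 1 - t 1 = 0
  · simp [h1]
  field_simp

/-- **Dilation move.** `W ≡ D(xy)`. -/
theorem ftLow_equiv : Equivalent (ftLow a c) (dilogCut (a.mul c)) :=
  equivalent_of_chart (isSemialgebraicMapOn_dilChart a c) (fun t _ => hasFDerivAt_dilChart c t)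
    (injective_dilChart c).injOn (image_dilChart a c) (fun _ _ => abs_det_dilDeriv c)
    (fun t _ => dilogFun_eq_dilChart c t) rfl (fun _ _ => rfl) rfl (fun _ _ => rfl)

/-- **`[V] = [D(x)] − [D(xy)]`** in `Q`. -/
theorem mkQ_ftWedge :
    mkQ (of (ftWedge a c)) = mkQ (of (dilogCut a)) - mkQ (of (dilogCut (a.mul c))) := by
  rw [eq_sub_iff_add_eq, ← map_add, mkQ_eq_mkQ_iff]
  have e : of (ftWedge a c) + of (dilogCut (a.mul c)) - of (dilogCut a) =
      -((of (ftLow a c) - of (dilogCut (a.mul c))) +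
        (of (dilogCut a) - of (ftLow a c) - of (ftWedge a c))) := by
    abel
  rw [e]
  exact neg_mem (add_mem (ftLow_equiv a c) (dilogCut_dissect_wedge a c))

end SoloBlind

end Summit.KontsevichZagierPeriods.KontsevichZagierPeriods.Theorems
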